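import Mathlib.Data.Rat.Defs
import Mathlib.RingTheory.Coprime.Basic
import Mathlib.Tactic.Linarith
import Mathlib.Tactic.NormNum
import Mathlib.Tactic.Ring
import Mathlib.Tactic.LinearCombination
import Mathlib.Tactic.Positivity
import HarnessLib

/-!
# The (0,1) cell of the ι-window, XXII: the product ground `B₁ × B₂`, IX — LINES `Φ∘T^k` over the classified classes: the arithmetic of
# LEMMA K / THEOREM L (stability of Fourier–Mukai transforms at fixed norm), the `s = 6` lines (ranks `37, 73, 121, …`), the line frames
# over the first / second / rank-two families, and the new atlas counts

Family `hodge`, b2b cell `hweil` (helper of item stmt-HodgeConjecture-2524). Companion (`pg9_*`) of `WeilTypeLadderH2ProductGroundEight{,B,C,D}.lean`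
(prover 1 gen 33). Report `run/shared/lean/b2b/hodge-weil/b2b-hweil-pv1-g34/H2-ZERO-ONE-22.md` ([XXII]). HONEST FRAMING: census results inside
the ladder's H2 test ((0,1) cell) on the SPECIAL fourfold `X₀ = B₁ × B₂`; emptiness / non-isolation of a family there is a census line and nothing
more. No case of the Hodge conjecture is proved; nothing here is a rung; no statement of [Markman 2025] / [Perry 2026] / [EdGFS 2025] is used.
Every head is the elementary arithmetic SHADOW of a named step of the report; the geometry (Mukai's Fourier functor and spectral sequence,
Yoshioka's Lemma 4.1, the cell's LEMMA D / U / JD / R2 / MR) is quoted print and certified items.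

Conventions as in the companions: classes `(r, c, s)` (`s = χ`), Mukai pairing `⟨(r,c,s),(r',c',s')⟩ = 2cc' − rs' − r's`, `χ = −⟨·,·⟩`, norm
`c² − rs`, slope `2c/r`; `T(r,c,s) = (r, c+r, s+2c+r)`, `Φ(r,c,s) = (s, −c, r)`; square classes `[(βX+δY)²] = (β², βδ, δ²)`,
`[2λλ'] = (2ββ', βδ'+β'δ, 2δδ')`; on linear forms `T : (β,δ) ↦ (β, β+δ)`, `Φ : (β,δ) ↦ (δ, −β)`, `∨ : (β,δ) ↦ (β, −δ)`.

* `pg9_itplus` — class bookkeeping of LEMMA IT⁺ (twists of duals of transforms are IT₀): `O(jΘ̂) = Φ(S_j)[2]` with `S_j` of the isotropic class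
  `(j², −j, 1)` (`χ = 1`, negative `c₁`), and `Ext^{2+i} = 0` on a surface for `i ≥ 1`.
* `pg9_lemmaK` — the class of the transform of the positive part `K₊` in LEMMA K: `v(Φ¹K₊) = (−t, e, −κ)`; with `e ≥ 1` and rank `−t ≥ 1` it has
  positive degree, against `μ_max(F₂) < 0`.
* `pg9_thmL_chain` — THEOREM L's integer chain: from `c² − rn = s`, `0 < s < c`, `1 ≤ a ≤ n−1`, `1 ≤ d`, `1 ≤ l`, `al ≤ d²`, `dn ≤ ac`, `1 ≤ j ≤ l`,
  `d ≤ δ`, `rδ + 1 ≤ cj`: `nl ≤ dc`, `d ≤ c−1`, `l ≤ r−1`, `c ≤ sj`, and `c = sj` forces the corner `nl = dc, j = l, δ = d, rd + 1 = cj`.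
* `pg9_thmL_corner` — the two corner exclusions: `dn = ac` with `c, n` coprime and `1 ≤ d ≤ c − 1` is absurd; the equal-slope corner
  `g n l = t c²`, `c² = rn + s`, `1 ≤ t ≤ 2`, `2s < n` is absurd.
* `pg9_s6_classes` — the `s = 6` lines: `T^k(6,3,1) = (6, 6k+3, 6k²+6k+1)`, norm `3`, Bezout `(2k+1)(6k+3) − 2(6k²+6k+1) = 1`, `Φ` of it,
  THEOREM L's threshold `6k+3 > 15 ⟺ k > 2`, `(c−1)c < 6n`, and the `k = 2` corner `5·37 ≠ 15d`.
* `pg9_s6_frames` — the two universal frames `((3k+2,−3),(k+1,−1))` (reading `(−(5k+4), 4k+3)`) and `((3k+1,3),(k,1))` (reading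
  `(−(5k+1), 4k+1)`): `det = 1`, classes `(6k²+6k+1, ∓(6k+3), 6)`, the bad quotient `u₀ + u₁ − n = ((2k+1)², −(4k+2), 4)` and sub
  `n − 4u₁ = (2k²+2k, −(2k+1), 2)`, bottom tests, slope comparisons.
* `pg9_s6_bad` — the bad members: the empty window (no integer `a` with `dn ≤ ac`, `2a < d(2k+1)`, `a ≤ n−1`), the Jordan–Hölder endgame
  `3(2k²+2k) < 6k²+6k+1`, and LEMMA D₁'s unit class.
* `pg9_lines_first` — frames of the four line families over `F_m`, `F_m^∨`: determinants `1`, class identities, bottom tests, thresholds.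
* `pg9_lines_second_t2` — frames of `L(G_b)`, `L(G_b^∨)^∨`, `L(W_K)`: determinants `−1`, class identities, bottom tests, thresholds.
* `pg9_counts` — the atlas of [XXII] §7: `169` new readings, `150 + 169 = 319` settled of `443`, `96 + 28 = 124` not settled.
-/

-- mandated namespace `Summit.HodgeConjecture.HodgeConjecture.…` (Problem = Summit) trips `linter.dupNamespace`; the lakefile disables it
-- tree-wide (weak option), restated here so stand-alone elaboration is warning-free too.
set_option linter.dupNamespace false

namespace Summit.HodgeConjecture.HodgeConjecture.WeilTypeLadder

section ProductGroundNine

/-- **LEMMA IT⁺ (report §2.1), class bookkeeping.** For `j ≥ 1` the simple semi-homogeneous bundle `S_j` of class `(j², −j, 1)` is isotropic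
with `χ = 1` and negative `c₁` (so IT₂), and `Φ(j², −j, 1) = (1, j, j²)` is the class of the line bundle `O(jΘ̂)`: `O(jΘ̂) ⊗ P = Φ(S_j)[2]`.
Hence `H^i((ΦY)^∨(jΘ̂)P) = Ext^{2+i}(Y, S_j) = 0` for `i ≥ 1` (`2 + i ≥ 3 > 2 = dim B`); for `j = 0`, `P_x = Φ(k(x))` (class `(0,0,1) ↦ (1,0,0)`)
and `Ext^i(Y, k(x)) = 0`, `i ≥ 1`, for `Y` locally free. [shadow: `ring` / `linarith`] -/
theorem pg9_itplus (j i : ℤ) (hj : 1 ≤ j) (hi : 1 ≤ i) :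
    ((-j) ^ 2 - j ^ 2 * 1 = 0) ∧ (-j < 0) ∧ (((1 : ℤ), -(-j), j ^ 2) = (1, j, j ^ 2)) ∧ (2 < 2 + i) ∧
    ((((1 : ℤ), -(0 : ℤ), (0 : ℤ)) = (1, 0, 0))) := by
  refine ⟨by ring, by linarith, by simp, by linarith, by simp⟩

/-- **LEMMA K (report §3.1), the class of the transform of the positive part.** If `K₊` (rank `κ`, `c₁ = eθ`, `χ = t`) is WIT₁, then
`v(Φ K₊) = Φ(κ, e, t) = (t, −e, κ)` and `Φ K₊ = Φ¹K₊[−1]`, so `v(Φ¹K₊) = (−t, e, −κ)`; a non-zero torsion-free sheaf of this class has rank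
`−t ≥ 1` and, when `e ≥ 1`, positive degree `2e > 0` — impossible inside `(−1)^*F₂` with `μ_max(F₂) < 0` (every non-zero subsheaf has negative
degree). [shadow: `simp` / `nlinarith`] -/
theorem pg9_lemmaK (κ e t : ℤ) (he : 1 ≤ e) (ht : 1 ≤ -t) :
    ((-(t : ℤ), -(-e), -κ) = (-t, e, -κ)) ∧ (0 < 2 * e) ∧ (0 < -t) ∧ ¬ (2 * e * 1 < 0 * (-t)) := by
  refine ⟨by simp, by linarith, by linarith, by nlinarith⟩

/-- **THEOREM L (report §3.3), the integer chain.** Source `X` μ-stable IT₀ torsion-free of class `(r, c, n)` with `c² − rn = s`, `0 < s < c`;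
transform `F = Φ(X)` of class `(n, −c, r)`; Gieseker–Harder–Narasimhan piece `F₁` of class `(a, −d, l)` with `1 ≤ a ≤ n − 1`, `1 ≤ d`
(Yoshioka 4.1 (1)), `1 ≤ l` (LEMMA D (iii)), `al ≤ d²` (Bogomolov), `dn ≤ ac` (`p(F₁) > p(F)`); LEMMA D (ii) + LEMMA K: `J ⊂ X'` of rank `j`,
`1 ≤ j ≤ l`, `c₁(J) = δθ` with `d ≤ δ`, and `μ(J) < μ(X)` i.e. `rδ + 1 ≤ cj` (for `j < r`). CONCLUSIONS: `nl ≤ dc`; `d ≤ c − 1`; `l ≤ r − 1`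
(so `j < r` is automatic); `c ≤ sj`; and in the boundary case `c = sj` every inequality is an equality: `nl = dc`, `j = l`, `δ = d`,
`rd + 1 = cj`. Hence `c > s(r−1) ≥ sj` is contradictory (THEOREM L), and `c = s(r−1)` leaves only the corner. [shadow: `nlinarith`] -/
theorem pg9_thmL_chain (r c n s a d l j δ : ℤ) (hs : c ^ 2 - r * n = s) (hs0 : 0 < s) (hsc : s < c)
    (ha1 : 1 ≤ a) (han : a ≤ n - 1) (hd : 1 ≤ d) (hl : 1 ≤ l) (hbog : a * l ≤ d ^ 2) (hp : d * n ≤ a * c)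
    (_hj1 : 1 ≤ j) (hjl : j ≤ l) (hK : d ≤ δ) (hJ : r * δ + 1 ≤ c * j) :
    (n * l ≤ d * c) ∧ (d ≤ c - 1) ∧ (l ≤ r - 1) ∧ (c ≤ s * j) ∧
    (c = s * j → (n * l = d * c ∧ j = l ∧ δ = d ∧ r * d + 1 = c * j)) := by
  have hc : 0 < c := by linarith only [hs0, hsc]
  have hn : 0 < n := by linarith only [ha1, han]
  have hc2 : s < c ^ 2 := by nlinarith only [hs0, hsc]
  have hrn : 0 < r * n := by linarith only [hs, hc2]
  have hr : 0 < r := (mul_pos_iff_of_pos_right hn).mp hrn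
  -- (i) d·n·l ≤ a·c·l ≤ d²·c
  have h1 : d * n * l ≤ a * c * l := mul_le_mul_of_nonneg_right hp (by linarith only [hl])
  have h2 : a * l * c ≤ d ^ 2 * c := mul_le_mul_of_nonneg_right hbog hc.le
  have h12 : d * (n * l) ≤ d * (d * c) := by
    have e1 : d * (n * l) = d * n * l := by ring
    have e2 : d * (d * c) = d ^ 2 * c := by ring
    have e3 : a * c * l = a * l * c := by ring
    rw [e1, e2]; rw [e3] at h1; exact le_trans h1 h2
  have hnl : n * l ≤ d * c := le_of_mul_le_mul_left h12 (by linarith only [hd])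
  -- (ii) d·n ≤ (n−1)·c < n·c
  have h6 : a * c ≤ (n - 1) * c := mul_le_mul_of_nonneg_right han hc.le
  have h7 : n * d < n * c := by
    have e1 : n * d = d * n := by ring
    have e2 : (n - 1) * c = n * c - c := by ring
    rw [e1]; rw [e2] at h6; linarith only [hp, h6, hc]
  have hdc' : d < c := lt_of_mul_lt_mul_left h7 hn.le
  have hdc : d ≤ c - 1 := by linarith only [Int.add_one_le_iff.mpr hdc']
  -- (iii) n·l ≤ d·c ≤ (c−1)·c < c² − s = r·n
  have h8 : d * c ≤ (c - 1) * c := mul_le_mul_of_nonneg_right hdc hc.le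
  have h9 : n * l < n * r := by
    have e1 : (c - 1) * c = c ^ 2 - c := by ring
    have e2 : n * r = r * n := by ring
    rw [e1] at h8; rw [e2]; linarith only [hnl, h8, hs, hsc]
  have hlr' : l < r := lt_of_mul_lt_mul_left h9 hn.le
  have hlr : l ≤ r - 1 := by linarith only [Int.add_one_le_iff.mpr hlr']
  -- (iv) n·j ≤ δ·c and r·δ·c + c ≤ c²·j = r·n·j + s·j ≤ r·δ·c + s·j
  have h10 : n * j ≤ n * l := mul_le_mul_of_nonneg_left hjl hn.le
  have h11 : d * c ≤ δ * c := mul_le_mul_of_nonneg_right hK hc.le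
  have hnj : n * j ≤ δ * c := by linarith only [h10, hnl, h11]
  have h3 : r * δ * c + c ≤ c * c * j := by
    have h := mul_le_mul_of_nonneg_right hJ hc.le
    have e1 : (r * δ + 1) * c = r * δ * c + c := by ring
    have e2 : c * j * c = c * c * j := by ring
    rw [e1, e2] at h; exact h
  have h4 : c * c * j = r * n * j + s * j := by linear_combination j * hs
  have h5 : r * n * j ≤ r * δ * c := by
    have h := mul_le_mul_of_nonneg_left hnj hr.le
    have e1 : r * (n * j) = r * n * j := by ring
    have e2 : r * (δ * c) = r * δ * c := by ring
    rw [e1, e2] at h; exact h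
  have hcsj : c ≤ s * j := by linarith only [h3, h4, h5]
  refine ⟨hnl, hdc, hlr, hcsj, fun heq => ?_⟩
  -- boundary case: every inequality is an equality
  have e1 : r * n * j = r * δ * c := by linarith only [h3, h4, h5, heq]
  have e2 : n * j = δ * c := by
    refine le_antisymm hnj ?_
    by_contra hlt
    have hlt' : n * j < δ * c := lt_of_not_ge hlt
    have := mul_lt_mul_of_pos_left hlt' hr
    have f1 : r * (n * j) = r * n * j := by ring
    have f2 : r * (δ * c) = r * δ * c := by ring
    rw [f1, f2] at this; linarith only [this, e1]
  have e3 : j = l := by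
    refine le_antisymm hjl ?_
    by_contra hlt
    have hlt' : j < l := lt_of_not_ge hlt
    have := mul_lt_mul_of_pos_left hlt' hn
    linarith only [this, e2, hnl, h11]
  have e4 : δ = d := by
    refine le_antisymm ?_ hK
    by_contra hlt
    have hlt' : d < δ := lt_of_not_ge hlt
    have := mul_lt_mul_of_pos_right hlt' hc
    linarith only [this, e2, h10, hnl]
  have e5 : r * δ * c + c = c * c * j := by linarith only [h3, h4, e1, heq]
  rw [e4] at e5
  have e6 : c * (r * d + 1) = c * (c * j) := by linear_combination e5
  refine ⟨?_, e3, e4, Int.eq_of_mul_eq_mul_left hc.ne' e6⟩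
  rw [e4] at e2
  linarith only [e2, h10, hnl, h11]

/-- **THEOREM L, the two corner exclusions (report §3.3 (v)).** (a) If `c` and `n` are coprime, `dn = ac` with `1 ≤ d ≤ c − 1` is impossible
(`c ∣ dn ⇒ c ∣ d ⇒ c ≤ d`). (b) In the equal-slope step (`g = gcd(n,c) = 3`, a μ-stable piece of class `(tn/g, −tc/g, l)`, `1 ≤ t ≤ 2`), the
corner `al = d²` reads `g·n·l = t·c²` with `c² = rn + s`; then `n(gl − tr) = ts`, impossible for `2s < n`. [shadow: `IsCoprime.dvd_of_dvd_mul_left`,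
`Int.le_of_dvd`, `nlinarith`] -/
theorem pg9_thmL_corner (r c n s a d l t g : ℤ) :
    (IsCoprime c n → d * n = a * c → 1 ≤ d → d ≤ c - 1 → False) ∧
    (c ^ 2 = r * n + s → 0 < s → 2 * s < n → 1 ≤ t → t ≤ 2 → g * n * l = t * c ^ 2 → False) := by
  constructor
  · intro hcop hdn hd hdc
    have hdvd : c ∣ d * n := ⟨a, by linarith⟩
    have hcd : c ∣ d := hcop.dvd_of_dvd_mul_right hdvd
    have : c ≤ d := Int.le_of_dvd (by linarith) hcd
    linarith
  · intro hcs hs hsn ht1 ht2 hg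
    have hn : 0 < n := by linarith
    have key : n * (g * l - t * r) = t * s := by
      have : g * n * l = t * (r * n + s) := by rw [← hcs]; exact hg
      linarith [this]
    rcases le_or_gt (g * l - t * r) 0 with h | h
    · have : n * (g * l - t * r) ≤ 0 := by nlinarith
      nlinarith
    · have h1 : 1 ≤ g * l - t * r := by linarith
      have : n ≤ n * (g * l - t * r) := by nlinarith
      nlinarith

/-- **The `s = 6` lines (report §4.1): classes.** One `T`-step `T(6, 6k+3, 6k²+6k+1) = (6, 6(k+1)+3, 6(k+1)²+6(k+1)+1)` (so
`T^k(6,3,1) = (6, 6k+3, 6k²+6k+1)` by induction from `k = 0`); norm `(6k+3)² − 6(6k²+6k+1) = 3`; the Bezout identity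
`(2k+1)(6k+3) − 2(6k²+6k+1) = 1` (so `gcd(c, n) = 1` and μ-semistable ⟹ μ-stable for the transform class `(6k²+6k+1, −(6k+3), 6)`), i.e.
`IsCoprime (6k+3) (6k²+6k+1)`; `2n = (2k+1)c − 1` (the bound `2d/l > 2n/c = 2k+1 − 1/c`); THEOREM L's uniform threshold
`3·(6−1) < 6k+3 ⟺ 2 < k` and the hypothesis `s = 3 < c`; `(c−1)c < 6n` (so `l ≤ 5`); and the `k = 2` boundary corner `nl = dc` with
`(n, c, l) = (37, 15, 5)`: `185 = 15d` has no integer solution. [shadow: `ring` / `omega` / `decide`] -/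
theorem pg9_s6_classes (k : ℤ) (hk : 1 ≤ k) :
    ((6 : ℤ) = 6 ∧ (6 * k + 3) + 6 = 6 * (k + 1) + 3 ∧ (6 * k ^ 2 + 6 * k + 1) + 2 * (6 * k + 3) + 6 = 6 * (k + 1) ^ 2 + 6 * (k + 1) + 1) ∧
    ((6 * k + 3) ^ 2 - 6 * (6 * k ^ 2 + 6 * k + 1) = 3) ∧
    ((2 * k + 1) * (6 * k + 3) - 2 * (6 * k ^ 2 + 6 * k + 1) = 1) ∧ IsCoprime (6 * k + 3) (6 * k ^ 2 + 6 * k + 1) ∧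
    (2 * (6 * k ^ 2 + 6 * k + 1) = (2 * k + 1) * (6 * k + 3) - 1) ∧
    ((3 : ℤ) * (6 - 1) < 6 * k + 3 ↔ 2 < k) ∧ (3 < 6 * k + 3) ∧
    ((6 * k + 3 - 1) * (6 * k + 3) < 6 * (6 * k ^ 2 + 6 * k + 1)) ∧
    (∀ d : ℤ, (37 : ℤ) * 5 ≠ 15 * d) := by
  refine ⟨⟨rfl, by ring, by ring⟩, by ring, by ring, ⟨2 * k + 1, -2, by ring⟩, by ring, ?_, by linarith, by nlinarith, ?_⟩
  · constructor <;> intro h <;> linarith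
  · intro d h; omega

/-- **The `s = 6` lines (report §4.3–4.4): the two universal frames.** MINUS line (class `v⁻ = (6k²+6k+1, −(6k+3), 6) = Φ(T^k(6,3,1))`, members
`Φ(R(kΘ))`): frame `λ₀ = (3k+2)X − 3Y`, `λ₁ = (k+1)X − Y` = `Φ∘T^k` of the `m = 3` neutral frame `((3,2),(1,1))`: `det = 1` (type I),
`u₀ − 3u₁ = v⁻`, the bad quotient `Ŝ'_k = u₀ + u₁ − n = [(λ₀−λ₁)²] = ((2k+1)², −(4k+2), 4)`, the bad sub `K'_k = n − 4u₁ = (2k²+2k, −(2k+1), 2)`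
(LEMMA D₁'s class), bottom test `b₀ = 3k+2 > 2(k+1) = 2b₁ ⟺ 0 < k`, chamber `(3k+2)² > 3(k+1)²`, reading `(a,b) = (−(b₀+2b₁), b₀+b₁) = (−(5k+4), 4k+3)`.
PLUS line (class `v⁺ = (6k²+6k+1, 6k+3, 6)`, members `Φ(R(kΘ))^∨ = ker(Φ(S(kΘ))^∨ ↠ ⊕Φ(P_z(kΘ))^∨)`): frame `λ₀ = (3k+1)X + 3Y`, `λ₁ = kX + Y`
= dual of `Φ∘T^k` of the cokernel frame `((3,1),(1,0))`: `det = 1`, `u₀ − 3u₁ = v⁺`, bottom `3k+1 > 2k`, chamber, reading `(−(5k+1), 4k+1)`.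
Slopes (cleared denominators): `μ(Ŝ') = −4/(2k+1) < μ(u₀) = −6/(3k+2)` iff `6(2k+1) < 4(3k+2)`; `μ(K') = −(2k+1)/(k²+k) < μ(Ŝ')` iff
`4(k²+k) < (2k+1)²`. [shadow: `ring` / `nlinarith`] -/
theorem pg9_s6_frames (k : ℤ) (hk : 1 ≤ k) :
    (((3 * k + 2) * (-1) - (k + 1) * (-3) = 1) ∧
     (((3 * k + 2) ^ 2 - 3 * (k + 1) ^ 2, (3 * k + 2) * (-3) - 3 * ((k + 1) * (-1)), (-3) ^ 2 - 3 * (-1) ^ 2) =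
        (6 * k ^ 2 + 6 * k + 1, -(6 * k + 3), (6 : ℤ))) ∧
     ((((3 * k + 2) - (k + 1)) ^ 2, ((3 * k + 2) - (k + 1)) * ((-3) - (-1)), ((-3 : ℤ) - (-1)) ^ 2) = ((2 * k + 1) ^ 2, -(4 * k + 2), (4 : ℤ))) ∧
     ((2 * (3 * k + 2) * (k + 1) - 4 * (k + 1) ^ 2, ((3 * k + 2) * (-1) + (k + 1) * (-3)) - 4 * ((k + 1) * (-1)), 2 * (-3) * (-1) - 4 * (-1) ^ 2) =
        (2 * k ^ 2 + 2 * k, -(2 * k + 1), (2 : ℤ))) ∧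
     (2 * (k + 1) < 3 * k + 2 ↔ 0 < k) ∧ (3 * (k + 1) ^ 2 < (3 * k + 2) ^ 2) ∧
     ((-((3 * k + 2) + 2 * (k + 1)), (3 * k + 2) + (k + 1)) = (-(5 * k + 4), 4 * k + 3))) ∧
    (((3 * k + 1) * 1 - k * 3 = 1) ∧
     (((3 * k + 1) ^ 2 - 3 * k ^ 2, (3 * k + 1) * 3 - 3 * (k * 1), (3 : ℤ) ^ 2 - 3 * 1 ^ 2) = (6 * k ^ 2 + 6 * k + 1, 6 * k + 3, (6 : ℤ))) ∧
     (2 * k < 3 * k + 1) ∧ (3 * k ^ 2 < (3 * k + 1) ^ 2) ∧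
     ((-((3 * k + 1) + 2 * k), (3 * k + 1) + k) = (-(5 * k + 1), 4 * k + 1))) ∧
    ((6 * (2 * k + 1) < 4 * (3 * k + 2)) ∧ (4 * (k ^ 2 + k) < (2 * k + 1) ^ 2)) := by
  refine ⟨⟨by ring, ?_, ?_, ?_, ?_, by nlinarith, ?_⟩, ⟨by ring, ?_, by linarith, by nlinarith, ?_⟩, ⟨by linarith, by nlinarith⟩⟩
  · ext <;> simp <;> ring
  · ext <;> simp <;> ring
  · ext <;> simp <;> ring
  · constructor <;> intro h <;> linarith
  · ext <;> simp <;> ring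
  · ext <;> simp <;> ring
  · ext <;> simp <;> ring

/-- **The `s = 6` lines (report §4.2): the bad members.** With `n = 6k²+6k+1`, `c = 6k+3`: (a) the EMPTY WINDOW — there is no integer `a` with
`1 ≤ d`, `a ≤ n − 1`, `dn ≤ ac` (destabilising) and `2a < d(2k+1)` (`μ(F₁) < μ(Ŝ') = −4/(2k+1)`, the hull bound for
`0 → K' → Φ(R(kΘ)) → Ŝ' → 0`): indeed `2a ≤ d(2k+1) − 1` gives `2ac ≤ d(2n+1) − c`, so `2dn ≤ 2dn + d − c`, `d ≥ c`, against `d ≤ c − 1`.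
(b) The Jordan–Hölder endgame of the LEMMA-K route for a strictly μ-semistable source: `a ≥ dn/c` with `d = 2k+1` means `3a ≥ n`, but
`a ≤ χ(U₃^∨(kΘ)) = 2k²+2k` and `3(2k²+2k) < n`. (c) LEMMA D₁'s hypothesis: the sub `U₃^∨(kΘ)` has the unit class `(2, 2k+1, 2k²+2k)`,
norm `1`. [shadow: `nlinarith`] -/
theorem pg9_s6_bad (k d a : ℤ) (hk : 1 ≤ k) :
    (1 ≤ d → a ≤ (6 * k ^ 2 + 6 * k + 1) - 1 → d * (6 * k ^ 2 + 6 * k + 1) ≤ a * (6 * k + 3) → 2 * a < d * (2 * k + 1) → False) ∧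
    (3 * a ≥ 6 * k ^ 2 + 6 * k + 1 → a ≤ 2 * k ^ 2 + 2 * k → False) ∧ (3 * (2 * k ^ 2 + 2 * k) < 6 * k ^ 2 + 6 * k + 1) ∧
    ((2 * k + 1) ^ 2 - 2 * (2 * k ^ 2 + 2 * k) = 1) := by
  refine ⟨fun hd han hp hw => ?_, fun h1 h2 => by linarith, by linarith, by ring⟩
  have h2a : 2 * a ≤ d * (2 * k + 1) - 1 := by linarith
  have hc : (2 * k + 1) * (6 * k + 3) = 2 * (6 * k ^ 2 + 6 * k + 1) + 1 := by ring
  -- 2ac ≤ (d(2k+1) − 1)(6k+3) = d(2n+1) − c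
  have h3 : 2 * a * (6 * k + 3) ≤ (d * (2 * k + 1) - 1) * (6 * k + 3) := by nlinarith
  have h4 : 2 * (d * (6 * k ^ 2 + 6 * k + 1)) ≤ 2 * a * (6 * k + 3) := by linarith
  nlinarith

/-- **Lines over the first family (report §5.2): frames, classes, bottoms, thresholds.** For `m ≥ 4`, `k ≥ 1`:
`L(F_m)` (source `F_m(kΘ̂)`, class `T^k(m²−3, −m, 1) = (m²−3, k(m²−3) − m, k²(m²−3) − 2km + 1)`, ALL members K-presented): frame
`Φ∘T^k((m,−1),(1,0)) = ((km−1, −m), (k, −1))`, `det = 1`, `u₀ − 3u₁ = Φ(class)`, bottom `km − 1 > 2k`, reading `(−(k(m+2)−1), k(m+1)−1)`;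
`L(F_m^∨)^∨` (members `Φ(F_m^∨(kΘ))^∨`, ALL K-presented): frame `((km+1, m), (k, 1))`, `det = 1`, class `(k²(m²−3)+2km+1, k(m²−3)+m, m²−3)`,
bottom `km+1 > 2k`, reading `(−(k(m+2)+1), k(m+1)+1)`; `L(F_m^∨)` (good K-presented): frame `((k(2m−3)+2, −(2m−3)), (k(m−2)+1, −(m−2)))`,
`det = 1`, bottom iff `0 < k`; `L(F_m)^∨` (good K-presented): frame `((k(2m−3)−2, 2m−3), (k(m−2)−1, m−2))`, `det = 1`. THEOREM L thresholds
(`s = 3`, `r = m²−3`): `k(m²−3) − m > 3(m²−4)` for `k ≥ 4`; `k(m²−3) + m > 3(m²−4)` for `k ≥ 3`. [shadow: `ring` / `nlinarith`] -/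
theorem pg9_lines_first (m k : ℤ) (hm : 4 ≤ m) (hk : 1 ≤ k) :
    (((k * m - 1) * (-1) - k * (-m) = 1) ∧
     (((k * m - 1) ^ 2 - 3 * k ^ 2, (k * m - 1) * (-m) - 3 * (k * (-1)), (-m) ^ 2 - 3 * (-1) ^ 2) =
        (k ^ 2 * (m ^ 2 - 3) - 2 * k * m + 1, -(k * (m ^ 2 - 3) - m), m ^ 2 - 3)) ∧
     (2 * k < k * m - 1) ∧ ((-((k * m - 1) + 2 * k), (k * m - 1) + k) = (-(k * (m + 2) - 1), k * (m + 1) - 1))) ∧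
    (((k * m + 1) * 1 - k * m = 1) ∧
     (((k * m + 1) ^ 2 - 3 * k ^ 2, (k * m + 1) * m - 3 * (k * 1), m ^ 2 - (3 : ℤ) * 1 ^ 2) =
        (k ^ 2 * (m ^ 2 - 3) + 2 * k * m + 1, k * (m ^ 2 - 3) + m, m ^ 2 - 3)) ∧
     (2 * k < k * m + 1) ∧ ((-((k * m + 1) + 2 * k), (k * m + 1) + k) = (-(k * (m + 2) + 1), k * (m + 1) + 1))) ∧
    (((k * (2 * m - 3) + 2) * (-(m - 2)) - (k * (m - 2) + 1) * (-(2 * m - 3)) = 1) ∧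
     (2 * (k * (m - 2) + 1) < k * (2 * m - 3) + 2 ↔ 0 < k) ∧
     ((k * (2 * m - 3) - 2) * (m - 2) - (k * (m - 2) - 1) * (2 * m - 3) = 1)) ∧
    ((4 ≤ k → 3 * (m ^ 2 - 3 - 1) < k * (m ^ 2 - 3) - m) ∧ (3 ≤ k → 3 * (m ^ 2 - 3 - 1) < k * (m ^ 2 - 3) + m)) := by
  refine ⟨⟨by ring, ?_, by nlinarith, ?_⟩, ⟨by ring, ?_, by nlinarith, ?_⟩, ⟨by ring, ?_, by ring⟩, ⟨fun h => ?_, fun h => ?_⟩⟩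
  · ext <;> simp <;> ring
  · ext <;> simp <;> ring
  · ext <;> simp <;> ring
  · ext <;> simp <;> ring
  · constructor <;> intro h <;> nlinarith
  · have hm2 : (0 : ℤ) ≤ m ^ 2 - 3 := by nlinarith
    nlinarith [mul_le_mul_of_nonneg_right h hm2]
  · have hm2 : (0 : ℤ) ≤ m ^ 2 - 3 := by nlinarith
    nlinarith [mul_le_mul_of_nonneg_right h hm2]

/-- **Lines over the second family and the rank-two transforms (report §5.3–5.4).** `L(G_b)` (source `G_b(kΘ̂)`, `b ≥ 2`, `k ≥ 1`, ALL members
K′-presented): frame `Φ∘T^k((1,0),(b,−1)) = ((k, −1), (kb−1, −b))` (type II: `u₀ = [(k,−1)²]`, three `u₁ = [(kb−1,−b)²]`), `det = −1`,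
`3u₁ − u₀ = (3(kb−1)² − k², −(k(3b²−1) − 3b), 3b²−1) = Φ(T^k(3b²−1, −3b, 3))`, bottom `2k < 3(kb−1)`, reading `(kb−1, kb−1+k)`;
`L(G_b^∨)^∨` (members `Φ(G_b^∨(kΘ))^∨`, ALL K′-presented): frame `((k, 1), (kb+1, b))`, `det = −1`, reading `(kb+1, kb+1+k)`; `L(W_K)` (source
`W_K(jΘ̂)`, `K ≥ 2`, `j ≥ 2`; LF members K′-presented): frame `((j(K+2)−1, −(K+2)), (j(K+1)−1, −(K+1)))`, `det = −1`, reading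
`(j(K+1)−1, j(2K+3)−2)`, the NL quotient class `[(j,−1)²] = (j², −j, 1)`. THEOREM L thresholds: `k(3b²−1) − 3b > 3(3b²−2)` for `k ≥ 4`,
`k(3b²−1) + 3b > 3(3b²−2)` for `k ≥ 3`; for the hull piece `A'(jΘ̂)` of the NL members (norm `1`, rank `2K²+2K`):
`j(2K²+2K) − (2K+1) > 2K²+2K−1` for `j ≥ 2`. [shadow: `ring` / `nlinarith`] -/
theorem pg9_lines_second_t2 (b k K j : ℤ) (hb : 2 ≤ b) (hk : 1 ≤ k) (hK : 2 ≤ K) (hj : 2 ≤ j) :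
    ((k * (-b) - (k * b - 1) * (-1) = -1) ∧
     ((3 * ((k * b - 1) * (-b)) - k * (-1) = -(k * (3 * b ^ 2 - 1) - 3 * b)) ∧ (3 * (-b) ^ 2 - (-1) ^ 2 = 3 * b ^ 2 - 1)) ∧
     ((3 * b ^ 2 - 1, -3 * b + k * (3 * b ^ 2 - 1), 3 + 2 * k * (-3 * b) + k ^ 2 * (3 * b ^ 2 - 1)) =
        (3 * b ^ 2 - 1, k * (3 * b ^ 2 - 1) - 3 * b, 3 * (k * b - 1) ^ 2 - k ^ 2)) ∧
     (2 ≤ k → 2 * k < 3 * (k * b - 1)) ∧ ((k * b - 1 + k) - (k * b - 1) = k)) ∧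
    ((k * b - (k * b + 1) * 1 = -1) ∧ ((k * b + 1 + k) - (k * b + 1) = k)) ∧
    (((j * (K + 2) - 1) * (-(K + 1)) - (j * (K + 1) - 1) * (-(K + 2)) = -1) ∧
     ((j * (K + 1) - 1) + (j * (K + 2) - 1) = j * (2 * K + 3) - 2) ∧ ((j ^ 2, j * (-1), (-1 : ℤ) ^ 2) = (j ^ 2, -j, 1))) ∧
    ((4 ≤ k → 3 * (3 * b ^ 2 - 1 - 1) < k * (3 * b ^ 2 - 1) - 3 * b) ∧ (3 ≤ k → 3 * (3 * b ^ 2 - 1 - 1) < k * (3 * b ^ 2 - 1) + 3 * b) ∧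
     (2 * K ^ 2 + 2 * K - 1 < j * (2 * K ^ 2 + 2 * K) - (2 * K + 1))) := by
  refine ⟨⟨by ring, ⟨by ring, by ring⟩, ?_, fun h2 => by nlinarith, by ring⟩, ⟨by ring, by ring⟩, ⟨by ring, by ring, ?_⟩,
    ⟨fun h => ?_, fun h => ?_, by nlinarith⟩⟩
  · ext <;> simp <;> ring
  · simp
  · have hb2 : (0 : ℤ) ≤ 3 * b ^ 2 - 1 := by nlinarith
    nlinarith [mul_le_mul_of_nonneg_right h hb2]
  · have hb2 : (0 : ℤ) ≤ 3 * b ^ 2 - 1 := by nlinarith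
    nlinarith [mul_le_mul_of_nonneg_right h hb2]

/-- **Atlas counts after [XXII] (report §7).** At height `≤ 40`: new readings settled by family — `s = 6` lines `6 + 6`, `L(F_m)` `24`,
`L(F_m)^∨` `6`, `L(F_m^∨)` `2`, `L(F_m^∨)^∨` `16`, `L(G_b)` `53 + 2` (two higher members `(12,31)`, `(13,34)`), `L(G_b^∨)^∨` `39`, `L(W_K)` `15`:
`167` bottoms `+ 2` higher members `= 169`; settled `150 + 169 = 319`, of `443`; not settled `443 − 319 = 124 = 96` open bottoms `+ 28`
partially analysed bottoms (good members presented, bad members untreated); old tally recomputed `126 + 22 + 2 = 150`; the scan of THEOREM L's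
criterion over the norm-3 classes `r < 80, c < 260`: `798` classes, `9` with numerical survivors. [shadow: `norm_num`] -/
theorem pg9_counts :
    (6 + 6 + 24 + 6 + 2 + 16 + 53 + 39 + 15 = (167 : ℕ)) ∧ (167 + 2 = (169 : ℕ)) ∧ (150 + 169 = (319 : ℕ)) ∧ (443 - 319 = (124 : ℕ)) ∧
    (96 + 28 = (124 : ℕ)) ∧ (126 + 22 + 2 = (150 : ℕ)) ∧ (319 + 96 + 28 = (443 : ℕ)) ∧ (798 - 9 = (789 : ℕ)) := by
  refine ⟨by norm_num, by norm_num, by norm_num, by norm_num, by norm_num, by norm_num, by norm_num, by norm_num⟩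

end ProductGroundNine

end Summit.HodgeConjecture.HodgeConjecture.WeilTypeLadder
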